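import Literature.AlgebraicGeometry.Motives.MixedHodgeStructureCatInternalHom
import Literature.AlgebraicGeometry.Motives.MixedHodgeStructureInternalHomUnit
import Literature.AlgebraicGeometry.Motives.MixedHodgeStructureInternalHomCurry
import HarnessLib

/-!
# The internal Hom of `MixedHodgeStructureCat`, II: `Hom(X, Y) ≅ X^∨ ⊗ Y`, `Hom(ℚ(0), Y) ≅ Y`, `Hom(X, ℚ(0)) ≅ X^∨`, composition, the duality
# pairing, `ℚ(0) ⊗ X ≅ X`, `ℚ(j) ⊗ X ≅ X(j)`

Layer `Literature/AlgebraicGeometry/Motives` (lane `lit-hodgefound`), continuing g45-#13 (`Motives/MixedHodgeStructureCatInternalHom`: `tensorObj`, `ihomObj`,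
`tensorHom`, `ihomMap`, `curry`, `evalHom`, `− ⊗ X ⊣ Hom(X, −)`).  The tree's unbundled comparison morphisms — `homToTensor` ∕ `tensorToHom`
(`Hom(H₁, H₂) ≅ H₁^∨ ⊗ H₂`, by DEFINITION of the internal Hom; `Motives/MixedHodgeStructureInternalHom`), `unitHomEval` (`Hom(ℚ(0), H) ≅ H`, `f ↦ f(1)`)
and `hom_unit_eq_dual` (`Hom(H, ℚ(0)) = H^∨`; `…InternalHomUnit`), `homComp` (composition `Hom(Y, Z) ⊗ Hom(X, Y) → Hom(X, Z)`) and `dualPairing`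
(`H^∨ ⊗ H → ℚ(0)`; `…InternalHomEvaluation`) — are stated here as isomorphisms and morphisms of `MixedHodgeStructureCat`, with the universe-polymorphic
Tate object `tateObj 0 = ℚ(0)` of g43-#11 (on `ULift ℚ`, compared with the tree's `ℚ(0)` on `ℚ` by `toTateObj` ∕ `ofTateObj`):

* §1 **`ihomIsoDualTensor X Y : Hom(X, Y) ≅ X^∨ ⊗ Y`** and the naturality square `Hom(f, g) ↔ f^∨ ⊗ g` (`ihomMap_eq_conj`, `ihomMap_comp_ihomIsoDualTensor_hom`);
* §2 **`ihomUnitIso Y : Hom(ℚ(0), Y) ≅ Y`** (`φ ↦ φ(1)`; Deligne–Milne (1.6.4)) and **`ihomIntoUnitIso X : Hom(X, ℚ(0)) ≅ X^∨`** (`φ ↦ (x ↦ φ(x))`,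
  El Zein–Lê: «in particular the dual `H^*` is a MHS»);
* §3 the composition morphism **`compHom X Y Z : Hom(Y, Z) ⊗ Hom(X, Y) ⟶ Hom(X, Z)`** (`g ⊗ f ↦ g ∘ f`) and its compatibility with evaluation;
* §4 the duality pairing **`evalPairing X : X^∨ ⊗ X ⟶ ℚ(0)`** (`φ ⊗ x ↦ φ(x)`), which is the evaluation of §2's `Hom(X, ℚ(0)) = X^∨`;
* §5 the unit for `⊗`: **`tensorUnitIso X : ℚ(0) ⊗ X ≅ X`** and **`tensorTateIso X j : ℚ(j) ⊗ X ≅ X(j)`** (Deligne 2.1.13 «`H(n) = H ⊗ ℤ(n)`»; the tree's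
  `unitTensorHom`, `tateTensorHom`, `Motives/MixedHodgeStructureTensorTate`).

Everything is PROVED; no named fact, no instance, no notation (data: the listed isomorphisms ∕ morphisms).

Sources, verbatim (through the tree's files).  P. Deligne, *Théorie de Hodge II* (1971) [DeligneHodgeII1971], 1.1.6 (dual filtration), 1.1.12 (`Hom`, `⊗`,
«compatibles à la composition»).  P. Deligne, J. S. Milne, *Tannakian categories*, LNM 900 (1982) [DeligneMilne1982Tannakian], §1 (1.6.2) (composition),
Def. 1.6 (`ev`), (1.6.4) `Hom(1, Hom(X, Y)) = Hom(X, Y)`, (1.6.5)–(1.7) (`X^∨ = Hom(X, 1)`, `ev_X : X^∨ ⊗ X → 1`).  E. Cattani et al. (eds.), *Hodge Theory*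
(2014) [CattaniElZeinGriffithsLe2014], Ch. 3 §3.2.2.7 p. 163 («`Hom(H, H')` … In particular the dual `H^*` … is a MHS»; `Hom(H₁, H₂) ≅ H₁^* ⊗ H₂`).

## Main results

* §0 `unitObj` (`= tateObj 0`), `finite_unitObj`, `toUnitObj`, `ofUnitObj`.
* §1 **`ihomIsoDualTensor`** (`_hom`, `_inv`), `ihomMap_eq_conj`, **`ihomMap_comp_ihomIsoDualTensor_hom`**.
* §2 `ihomUnitHom`, `ihomUnitHom_toLinearMap_apply`, `ihomUnitHom_bijective`, **`ihomUnitIso`** (`_hom`), `ihomUnitHom_naturality`; `ihomIntoUnitHom`,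
  `ihomIntoUnitHom_toLinearMap_apply`, `ihomIntoUnitHom_bijective`, **`ihomIntoUnitIso`** (`_hom`), `ihomIntoUnitHom_naturality`.
* §3 **`compHom`**, `compHom_toLinearMap_apply_tmul`, **`evalHom_compHom_tmul`**, `curry_compHom_toLinearMap_apply`.
* §4 **`evalPairing`**, `evalPairing_toLinearMap_apply_tmul`, **`evalPairing_eq`** (`= (ihomIntoUnitIso⁻¹ ⊗ 𝟙) ≫ ev`).
* §5 `finite_tateObj`, `tensorUnitHom`, `tensorUnitHom_toLinearMap_apply_tmul`, `tensorUnitHom_bijective`, **`tensorUnitIso`**, `tensorTateHom`, `tensorTateHom_bijective`, **`tensorTateIso`**.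

## References

* [DeligneHodgeII1971] P. Deligne, Théorie de Hodge II, Publ. Math. IHÉS 40 (1971), 1.1.6, 1.1.12, 2.1.13.
* [DeligneMilne1982Tannakian] P. Deligne, J. S. Milne, Tannakian categories, in LNM 900 (1982), §1 (1.6.2), Def. 1.6, (1.6.4), (1.6.5)–(1.7).
* [CattaniElZeinGriffithsLe2014] E. Cattani et al. (eds.), Hodge Theory, Princeton Math. Notes 49 (2014), Ch. 3 §3.2.2.7 p. 163.

## Provenance

Lane `lit-hodgefound` (summit `HodgeConjecture`), seat `lit-hodgefound-p36` (literature-prover, generation 45, row g45-#14).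
-/

noncomputable section

open CategoryTheory CategoryTheory.Limits
open scoped TensorProduct

namespace Literature.AlgebraicGeometry.Motives

universe u

namespace MixedHodgeStructureCat

variable {X X' Y Y' Z : MixedHodgeStructureCat.{u}} [Module.Finite ℚ X] [Module.Finite ℚ X'] [Module.Finite ℚ Y] [Module.Finite ℚ Y'] [Module.Finite ℚ Z]

/-! ## §0 The unit object -/

/-- **The unit object `ℚ(0)`** of `MixedHodgeStructureCat.{u}` — a REDUCIBLE synonym of g43-#11's `tateObj 0` (the Tate structure `ℚ(0)` on `ULift ℚ`), so that
the instances on its carrier are found when it is fed to `ihomObj` ∕ `tensorObj`. [cite: DeligneHodgeII1971, 2.1.13] [cite: DeligneMilne1982Tannakian, §1 (1.6.4)] -/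
abbrev unitObj : MixedHodgeStructureCat.{u} := of ((HodgeStructure.tate 0).toMixedHodgeStructure.comapEquiv uliftRatEquiv.{u})

/-- `unitObj = tateObj 0` (by `rfl`). [cite: DeligneHodgeII1971, 2.1.13] -/
theorem unitObj_eq_tateObj : unitObj.{u} = tateObj 0 := rfl

/-- `ℚ(0)` is finite-dimensional (one-dimensional). [cite: DeligneHodgeII1971, 2.1.13] -/
theorem finite_unitObj : Module.Finite ℚ unitObj.{u} := inferInstanceAs (Module.Finite ℚ (ULift.{u} ℚ))

/-- The comparison `ℚ(0) → ℚ(0)_{ULift}` (g43-#11 `toTateObj 0`, typed with `unitObj`). [cite: DeligneHodgeII1971, 2.1.13] -/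
abbrev toUnitObj : MixedHodgeStructure.Hom (HodgeStructure.tate 0).toMixedHodgeStructure unitObj.{u}.str := toTateObj.{u} 0

/-- The comparison `ℚ(0)_{ULift} → ℚ(0)` (g43-#11 `ofTateObj 0`, typed with `unitObj`). [cite: DeligneHodgeII1971, 2.1.13] -/
abbrev ofUnitObj : MixedHodgeStructure.Hom unitObj.{u}.str (HodgeStructure.tate 0).toMixedHodgeStructure := ofTateObj.{u} 0

/-! ## §1 `Hom(X, Y) ≅ X^∨ ⊗ Y` -/

variable (X Y) in
/-- **`Hom(X, Y) ≅ X^∨ ⊗ Y`** in `MixedHodgeStructureCat` (the tree's `homToTensor` ∕ `tensorToHom`; the internal Hom is DEFINED by transport of `X^∨ ⊗ Y`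
along `X^∨ ⊗ Y ≃ Hom_ℚ(X, Y)`). [cite: CattaniElZeinGriffithsLe2014, Ch. 3 §3.2.2.7 p. 163] [cite: DeligneHodgeII1971, 1.1.12] -/
def ihomIsoDualTensor : ihomObj X Y ≅ tensorObj (of X.str.dual) Y where
  hom := MixedHodgeStructure.homToTensor X.str Y.str
  inv := MixedHodgeStructure.tensorToHom X.str Y.str
  hom_inv_id := MixedHodgeStructure.tensorToHom_comp_homToTensor X.str Y.str
  inv_hom_id := MixedHodgeStructure.homToTensor_comp_tensorToHom X.str Y.str

variable (X Y) in
/-- Unfolding `ihomIsoDualTensor` (hom). [cite: CattaniElZeinGriffithsLe2014, Ch. 3 §3.2.2.7 p. 163] -/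
theorem ihomIsoDualTensor_hom : (ihomIsoDualTensor X Y).hom = MixedHodgeStructure.homToTensor X.str Y.str := rfl

variable (X Y) in
/-- Unfolding `ihomIsoDualTensor` (inv). [cite: CattaniElZeinGriffithsLe2014, Ch. 3 §3.2.2.7 p. 163] -/
theorem ihomIsoDualTensor_inv : (ihomIsoDualTensor X Y).inv = MixedHodgeStructure.tensorToHom X.str Y.str := rfl

/-- `(X^∨ ⊗ Y → Hom(X, Y))(φ ⊗ y) = (x ↦ φ(x) y)`. [cite: CattaniElZeinGriffithsLe2014, Ch. 3 §3.2.2.7 p. 163] -/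
theorem ihomIsoDualTensor_inv_toLinearMap_apply_tmul (φ : Module.Dual ℚ X) (y : Y) (x : X) :
    (ihomIsoDualTensor X Y).inv.toLinearMap (φ ⊗ₜ[ℚ] y) x = φ x • y :=
  MixedHodgeStructure.tensorToHom_apply_tmul X.str Y.str φ y x

/-- **`Hom(f, g) = (Hom(X, Y) ≅ X^∨ ⊗ Y) ≫ (f^∨ ⊗ g) ≫ (X'^∨ ⊗ Y' ≅ Hom(X', Y'))`** — the definition of the tree's `Hom.homMap`.
[cite: DeligneHodgeII1971, 1.1.12] -/
theorem ihomMap_eq_conj (f : X' ⟶ X) (g : Y ⟶ Y') :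
    ihomMap f g = (ihomIsoDualTensor X Y).hom ≫ tensorHom (transposeHom f) g ≫ (ihomIsoDualTensor X' Y').inv :=
  hom_ext (LinearMap.ext fun _ => rfl)

/-- **Naturality of `Hom(X, Y) ≅ X^∨ ⊗ Y`**: `Hom(f, g) ≫ (≅) = (≅) ≫ (f^∨ ⊗ g)`. [cite: DeligneHodgeII1971, 1.1.12] -/
theorem ihomMap_comp_ihomIsoDualTensor_hom (f : X' ⟶ X) (g : Y ⟶ Y') :
    ihomMap f g ≫ (ihomIsoDualTensor X' Y').hom = (ihomIsoDualTensor X Y).hom ≫ tensorHom (transposeHom f) g := by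
  rw [ihomMap_eq_conj, Category.assoc, Category.assoc, Iso.inv_hom_id, Category.comp_id]

/-! ## §2 `Hom(ℚ(0), Y) ≅ Y` and `Hom(X, ℚ(0)) ≅ X^∨` -/

variable (Y) in
/-- **`Hom(ℚ(0), Y) ⟶ Y`, `φ ↦ φ(1)`** (the tree's `unitHomEval`, pulled back along `toTateObj 0 : ℚ(0) → ℚ(0)_{ULift}`).
[cite: DeligneMilne1982Tannakian, §1 (1.6.4)] -/
def ihomUnitHom : ihomObj unitObj.{u} Y ⟶ Y :=
  (MixedHodgeStructure.unitHomEval Y.str).comp (MixedHodgeStructure.Hom.homMap toUnitObj.{u} (MixedHodgeStructure.Hom.id Y.str))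

/-- `ihomUnitHom Y φ = φ(1)`. [cite: DeligneMilne1982Tannakian, §1 (1.6.4)] -/
theorem ihomUnitHom_toLinearMap_apply (φ : unitObj.{u} →ₗ[ℚ] Y) : (ihomUnitHom Y).toLinearMap φ = φ (ULift.up 1) := by
  change (MixedHodgeStructure.unitHomEval Y.str).toLinearMap
      ((MixedHodgeStructure.Hom.homMap toUnitObj.{u} (MixedHodgeStructure.Hom.id Y.str)).toLinearMap φ) = _
  rw [MixedHodgeStructure.Hom.homMap_toLinearMap_apply, MixedHodgeStructure.unitHomEval_toLinearMap_apply]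
  rfl

variable (Y) in
/-- `φ ↦ φ(1)` is bijective. [cite: DeligneMilne1982Tannakian, §1 (1.6.4)] -/
theorem ihomUnitHom_bijective : Function.Bijective (ihomUnitHom Y).toLinearMap :=
  (MixedHodgeStructure.unitHomEval_bijective Y.str).comp
    (MixedHodgeStructure.Hom.homMap_bijective toUnitObj.{u} (MixedHodgeStructure.Hom.id Y.str) (uliftRatEquiv.{u}).symm.bijective
      Function.bijective_id)

variable (Y) in
/-- **`Hom(ℚ(0), Y) ≅ Y`** in `MixedHodgeStructureCat` («`Hom(1, Hom(X, Y)) = Hom(X, Y)`» with `X = 1`: the unit is a unit for the internal Hom).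
[cite: DeligneMilne1982Tannakian, §1 (1.6.4)] -/
def ihomUnitIso : ihomObj unitObj.{u} Y ≅ Y := @asIso _ _ _ _ (ihomUnitHom Y) (isIso_of_bijective _ (ihomUnitHom_bijective Y))

variable (Y) in
/-- Unfolding `ihomUnitIso`. [cite: DeligneMilne1982Tannakian, §1 (1.6.4)] -/
theorem ihomUnitIso_hom : (ihomUnitIso Y).hom = ihomUnitHom Y := rfl

/-- Naturality of `φ ↦ φ(1)`: `Hom(𝟙, g) ≫ (φ ↦ φ 1) = (φ ↦ φ 1) ≫ g`. [cite: DeligneMilne1982Tannakian, §1 (1.6.4)] -/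
theorem ihomUnitHom_naturality (g : Y ⟶ Y') : ihomMap (𝟙 unitObj.{u}) g ≫ ihomUnitHom Y' = ihomUnitHom Y ≫ g := by
  apply hom_ext
  refine LinearMap.ext fun φ => ?_
  rw [comp_toLinearMap, comp_toLinearMap, LinearMap.comp_apply, LinearMap.comp_apply, ihomUnitHom_toLinearMap_apply, ihomMap_toLinearMap_apply,
    ihomUnitHom_toLinearMap_apply]
  rfl

variable (X) in
/-- **`Hom(X, ℚ(0)) ⟶ X^∨`, `φ ↦ (x ↦ φ(x))`**: through `Hom(𝟙, ofTateObj 0) : Hom(X, ℚ(0)_{ULift}) → Hom(X, ℚ(0))` and the EQUALITY of mixed Hodge structures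
`Hom(X, ℚ(0)) = X^∨` (the tree's `hom_unit_eq_dual`). [cite: CattaniElZeinGriffithsLe2014, Ch. 3 §3.2.2.7 p. 163] [cite: DeligneHodgeII1971, 1.1.6 and 1.1.12] -/
def ihomIntoUnitHom : ihomObj X unitObj.{u} ⟶ of X.str.dual :=
  (MixedHodgeStructure.Hom.ofEq (MixedHodgeStructure.hom_unit_eq_dual X.str)).comp
    (MixedHodgeStructure.Hom.homMap (MixedHodgeStructure.Hom.id X.str) ofUnitObj.{u})

/-- `ihomIntoUnitHom X φ = (x ↦ (φ x).down)`. [cite: CattaniElZeinGriffithsLe2014, Ch. 3 §3.2.2.7 p. 163] -/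
theorem ihomIntoUnitHom_toLinearMap_apply (φ : X →ₗ[ℚ] unitObj.{u}) (x : X) : (ihomIntoUnitHom X).toLinearMap φ x = (φ x).down := by
  change (MixedHodgeStructure.Hom.homMap (MixedHodgeStructure.Hom.id X.str) ofUnitObj.{u}).toLinearMap φ x = _
  rw [MixedHodgeStructure.Hom.homMap_toLinearMap_apply]
  rfl

variable (X) in
/-- `φ ↦ (x ↦ φ(x))` is bijective. [cite: CattaniElZeinGriffithsLe2014, Ch. 3 §3.2.2.7 p. 163] -/
theorem ihomIntoUnitHom_bijective : Function.Bijective (ihomIntoUnitHom X).toLinearMap :=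
  Function.bijective_id.comp
    (MixedHodgeStructure.Hom.homMap_bijective (MixedHodgeStructure.Hom.id X.str) ofUnitObj.{u} Function.bijective_id (uliftRatEquiv.{u}).bijective)

variable (X) in
/-- **`Hom(X, ℚ(0)) ≅ X^∨`** in `MixedHodgeStructureCat` («In particular the dual `H^*` … is a MHS»; Deligne–Milne (1.7) `X^∨ = Hom(X, 1)`).
[cite: CattaniElZeinGriffithsLe2014, Ch. 3 §3.2.2.7 p. 163] [cite: DeligneMilne1982Tannakian, §1 (1.7)] -/
def ihomIntoUnitIso : ihomObj X unitObj.{u} ≅ of X.str.dual :=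
  @asIso _ _ _ _ (ihomIntoUnitHom X) (isIso_of_bijective _ (ihomIntoUnitHom_bijective X))

variable (X) in
/-- Unfolding `ihomIntoUnitIso`. [cite: CattaniElZeinGriffithsLe2014, Ch. 3 §3.2.2.7 p. 163] -/
theorem ihomIntoUnitIso_hom : (ihomIntoUnitIso X).hom = ihomIntoUnitHom X := rfl

/-- Naturality: `Hom(f, 𝟙) ≫ (Hom(X, ℚ(0)) ≅ X^∨) = (Hom(X', ℚ(0)) ≅ X'^∨) ≫ f^∨`. [cite: DeligneHodgeII1971, 1.1.6 and 1.1.12] -/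
theorem ihomIntoUnitHom_naturality (f : X ⟶ X') : ihomMap f (𝟙 unitObj.{u}) ≫ ihomIntoUnitHom X = ihomIntoUnitHom X' ≫ transposeHom f := by
  apply hom_ext
  refine LinearMap.ext fun φ => LinearMap.ext fun x => ?_
  rw [comp_toLinearMap, comp_toLinearMap, LinearMap.comp_apply, LinearMap.comp_apply, ihomIntoUnitHom_toLinearMap_apply, ihomMap_toLinearMap_apply,
    transposeHom_toLinearMap, LinearMap.dualMap_apply, ihomIntoUnitHom_toLinearMap_apply]
  rfl

/-! ## §3 Composition -/

variable (X Y Z) in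
/-- **The composition morphism `Hom(Y, Z) ⊗ Hom(X, Y) ⟶ Hom(X, Z)`, `g ⊗ f ↦ g ∘ f`** (the tree's `homComp`).
[cite: DeligneHodgeII1971, 1.1.12] [cite: DeligneMilne1982Tannakian, §1 (1.6.2)] -/
abbrev compHom : tensorObj (ihomObj Y Z) (ihomObj X Y) ⟶ ihomObj X Z := MixedHodgeStructure.homComp X.str Y.str Z.str

/-- `compHom (g ⊗ f) = g ∘ f`. [cite: DeligneMilne1982Tannakian, §1 (1.6.2)] -/
theorem compHom_toLinearMap_apply_tmul (g : Y →ₗ[ℚ] Z) (f : X →ₗ[ℚ] Y) : (compHom X Y Z).toLinearMap (g ⊗ₜ[ℚ] f) = g ∘ₗ f := rfl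

/-- **Composition then evaluation is iterated evaluation**: `ev((g ∘ f) ⊗ x) = ev(g ⊗ ev(f ⊗ x))`. [cite: DeligneMilne1982Tannakian, §1 Def. 1.6 and (1.6.2)] -/
theorem evalHom_compHom_tmul (g : Y →ₗ[ℚ] Z) (f : X →ₗ[ℚ] Y) (x : X) :
    (evalHom X Z).toLinearMap ((compHom X Y Z).toLinearMap (g ⊗ₜ[ℚ] f) ⊗ₜ[ℚ] x) = (evalHom Y Z).toLinearMap (g ⊗ₜ[ℚ] (evalHom X Y).toLinearMap (f ⊗ₜ[ℚ] x)) :=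
  rfl

/-- The curried composition `Hom(Y, Z) ⟶ Hom(Hom(X, Y), Hom(X, Z))`, `g ↦ (f ↦ g ∘ f)`, is `curry compHom`. [cite: DeligneMilne1982Tannakian, §1 (1.6.2)] -/
theorem curry_compHom_toLinearMap_apply (g : Y →ₗ[ℚ] Z) (f : X →ₗ[ℚ] Y) : (curry (compHom X Y Z)).toLinearMap g f = g ∘ₗ f := rfl

/-! ## §4 The duality pairing -/

variable (X) in
/-- **The duality pairing `X^∨ ⊗ X ⟶ ℚ(0)`, `φ ⊗ x ↦ φ(x)`** (the tree's `dualPairing`, followed by `toTateObj 0`). [cite: DeligneHodgeII1971, 1.1.6 and 1.1.12]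
[cite: DeligneMilne1982Tannakian, §1 (1.6.5)] -/
def evalPairing : tensorObj (of X.str.dual) X ⟶ unitObj.{u} := toUnitObj.{u}.comp (MixedHodgeStructure.dualPairing X.str)

/-- `evalPairing (φ ⊗ x) = φ(x)`. [cite: DeligneMilne1982Tannakian, §1 (1.6.5)] -/
theorem evalPairing_toLinearMap_apply_tmul (φ : Module.Dual ℚ X) (x : X) : (evalPairing X).toLinearMap (φ ⊗ₜ[ℚ] x) = ULift.up (φ x) := rfl

/-- **The duality pairing is the evaluation of `Hom(X, ℚ(0))`** transported along `Hom(X, ℚ(0)) ≅ X^∨`: `evalPairing = ((≅)⁻¹ ⊗ 𝟙) ≫ ev`.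
[cite: DeligneMilne1982Tannakian, §1 Def. 1.6 and (1.6.5)] -/
theorem evalPairing_eq : evalPairing X = tensorHom (ihomIntoUnitIso X).inv (𝟙 X) ≫ evalHom X unitObj.{u} := by
  apply hom_ext
  refine TensorProduct.ext' fun φ x => ?_
  have h1 : (ihomIntoUnitIso X).hom.toLinearMap ((uliftRatEquiv.{u}).symm.toLinearMap ∘ₗ φ) = φ := by
    refine LinearMap.ext fun y => ?_
    rw [ihomIntoUnitIso_hom, ihomIntoUnitHom_toLinearMap_apply]
    rfl
  have h2 : (ihomIntoUnitIso X).inv.toLinearMap φ = (uliftRatEquiv.{u}).symm.toLinearMap ∘ₗ φ := by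
    conv_lhs => rw [← h1]
    rw [← LinearMap.comp_apply, ← comp_toLinearMap, Iso.hom_inv_id]
    rfl
  rw [comp_toLinearMap, LinearMap.comp_apply, tensorHom_toLinearMap_apply_tmul, evalHom_toLinearMap_apply_tmul, evalPairing_toLinearMap_apply_tmul, h2]
  rfl

/-! ## §5 The unit for `⊗`: `ℚ(0) ⊗ X ≅ X`, `ℚ(j) ⊗ X ≅ X(j)` -/

/-- `ℚ(j)` is finite-dimensional. [cite: DeligneHodgeII1971, 2.1.13] -/
theorem finite_tateObj (j : ℤ) : Module.Finite ℚ (tateObj.{u} j) := inferInstanceAs (Module.Finite ℚ (ULift.{u} ℚ))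

variable (X) in
/-- **`ℚ(0) ⊗ X ⟶ X`, `q ⊗ x ↦ q • x`** (the tree's `unitTensorHom`, after `ofUnitObj ⊗ 𝟙 : ℚ(0)_{ULift} ⊗ X → ℚ(0) ⊗ X`). [cite: DeligneHodgeII1971, 2.1.13] -/
def tensorUnitHom : tensorObj unitObj.{u} X ⟶ X :=
  (MixedHodgeStructure.unitTensorHom X.str).comp (MixedHodgeStructure.Hom.tensorMap ofUnitObj.{u} (MixedHodgeStructure.Hom.id X.str))

/-- `tensorUnitHom X (q ⊗ x) = q • x`. [cite: DeligneHodgeII1971, 2.1.13] -/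
theorem tensorUnitHom_toLinearMap_apply_tmul (q : unitObj.{u}) (x : X) : (tensorUnitHom X).toLinearMap (q ⊗ₜ[ℚ] x) = q.down • x := by
  change (MixedHodgeStructure.unitTensorHom X.str).toLinearMap
      ((MixedHodgeStructure.Hom.tensorMap ofUnitObj.{u} (MixedHodgeStructure.Hom.id X.str)).toLinearMap (q ⊗ₜ[ℚ] x)) = _
  rw [MixedHodgeStructure.Hom.tensorMap_apply_tmul, MixedHodgeStructure.unitTensorHom_toLinearMap, LinearEquiv.coe_coe, TensorProduct.lid_tmul]
  rfl

variable (X) in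
/-- `q ⊗ x ↦ q • x` is bijective. [cite: DeligneHodgeII1971, 2.1.13] -/
theorem tensorUnitHom_bijective : Function.Bijective (tensorUnitHom X).toLinearMap :=
  (MixedHodgeStructure.unitTensorHom_bijective X.str).comp (TensorProduct.congr uliftRatEquiv.{u} (LinearEquiv.refl ℚ X)).bijective

variable (X) in
/-- **`ℚ(0) ⊗ X ≅ X`**: `ℚ(0)` is a unit for `⊗` (Deligne 2.1.13 with `n = 0`: `H(0) = H ⊗ ℤ(0) = H`). [cite: DeligneHodgeII1971, 2.1.13] -/
def tensorUnitIso : tensorObj unitObj.{u} X ≅ X := @asIso _ _ _ _ (tensorUnitHom X) (isIso_of_bijective _ (tensorUnitHom_bijective X))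

variable (X) in
/-- Unfolding `tensorUnitIso`. [cite: DeligneHodgeII1971, 2.1.13] -/
theorem tensorUnitIso_hom : (tensorUnitIso X).hom = tensorUnitHom X := rfl

variable (X) in
/-- **`ℚ(j) ⊗ X ⟶ X(j)`, `q ⊗ x ↦ q • x`** (the tree's `tateTensorHom`; «`H(n) = H ⊗ ℤ(n)`»). [cite: DeligneHodgeII1971, 2.1.13] -/
def tensorTateHom (j : ℤ) : haveI := finite_tateObj.{u} j; (tensorObj (tateObj.{u} j) X ⟶ (tateTwist j).obj X) :=
  haveI := finite_tateObj.{u} j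
  ((MixedHodgeStructure.tateTensorHom X.str j).comp (MixedHodgeStructure.Hom.tensorMap (ofTateObj.{u} j) (MixedHodgeStructure.Hom.id X.str)) :
    tensorObj (tateObj.{u} j) X ⟶ (tateTwist j).obj X)

variable (X) in
/-- `q ⊗ x ↦ q • x : ℚ(j) ⊗ X → X(j)` is bijective. [cite: DeligneHodgeII1971, 2.1.13] -/
theorem tensorTateHom_bijective (j : ℤ) : Function.Bijective (tensorTateHom X j).toLinearMap :=
  (MixedHodgeStructure.tateTensorHom_bijective X.str j).comp (TensorProduct.congr uliftRatEquiv.{u} (LinearEquiv.refl ℚ X)).bijective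

variable (X) in
/-- **`ℚ(j) ⊗ X ≅ X(j)`**: the Tate twist is tensoring with the Tate object. [cite: DeligneHodgeII1971, 2.1.13] [cite: CattaniElZeinGriffithsLe2014, Ex. 3.2.23 (4)] -/
def tensorTateIso (j : ℤ) : haveI := finite_tateObj.{u} j; (tensorObj (tateObj.{u} j) X ≅ (tateTwist j).obj X) :=
  haveI := finite_tateObj.{u} j
  @asIso _ _ _ _ (tensorTateHom X j) (isIso_of_bijective _ (tensorTateHom_bijective X j))

end MixedHodgeStructureCat

end Literature.AlgebraicGeometry.Motives
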